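import Mathlib
import Summits.ValiantsHypothesis.ValiantsHypothesis.Theses.BarrierLever
import Summits.ValiantsHypothesis.ValiantsHypothesis.Theorems.BarrierLeverPrincipalMinorLayoutsNonsingularRefutation
import Summits.ValiantsHypothesis.ValiantsHypothesis.Theorems.BarrierLeverTransversalSufficesForPrincipal
import Summits.ValiantsHypothesis.ValiantsHypothesis.Theorems.BarrierLeverParabolicCertificatesDecideTransversalHolds

/-!
# Route BarrierLever — item `ParabolicCertificatesExist` (stmt-ValiantsHypothesis-19689): REFUTATION

Refutation file (`--workitem stmt-ValiantsHypothesis-19689`; cell valiant-natproofs, rung V4, 𝒟-side;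
prover seat val-np-p3 gen 4). Definition-free; a corollary of the refutation of TNS
(`TNSRefutation.not_PrincipalMinorLayoutsNonsingular`, item 19126: at `h = 31` the layout
`u = (∅, {0}, …, {30})`, `w =` all subsets of `{0,…,4}` has a singular principal-minor layout
matrix for EVERY `K`) through arrows already in the tree.

**`not_ParabolicCertificatesExist`**: parabolic certificates do NOT exist for every layout, since
`ParabolicCertificatesExist → TT` (item 19690, `ParabolicCert.parabolicCertificatesDecideTransversal_route`),
TT ⇒ TNS (19153), and TNS is false.

WHAT THIS IS NOT: item 19717 `PartitionMinorsHitByVP` (layout-dependent witnesses) is untouched;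
nothing on crux stmt-14610 or `VP` vs `VNP`.
-/

set_option linter.dupNamespace false

namespace Summit.ValiantsHypothesis.ValiantsHypothesis.Theorems.BarrierLever.TNSRefutation

/-- **Parabolic certificates do not always exist** (item `ParabolicCertificatesExist`,
stmt-ValiantsHypothesis-19689): by the proved glue 19690, TT ⇒ TNS (19153) and the refutation of TNS. -/
theorem not_ParabolicCertificatesExist :
    ¬ Summit.ValiantsHypothesis.ValiantsHypothesis.Theses.BarrierLever.ParabolicCertificatesExist :=
  fun hP => not_PrincipalMinorLayoutsNonsingular
    (TransversalDictionary.transversalSufficesForPrincipal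
      (ParabolicCert.parabolicCertificatesDecideTransversal_route hP))

end Summit.ValiantsHypothesis.ValiantsHypothesis.Theorems.BarrierLever.TNSRefutation
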